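import Summits.ValiantsHypothesis.ValiantsHypothesis.Theses.DivisionGap

/-! Sketch: the two children of the charged/uncharged split elaborate inside the route namespace,
and the glue typechecks against the NAMED defs by unfolding (defeq test for `--glue-by`). -/

set_option linter.dupNamespace false

namespace Summit.ValiantsHypothesis.ValiantsHypothesis.Theses.DivisionGap

/-- child 1 (uncharged transfer) -/
def MonotoneMultiples' : Prop :=
  ∀ (σ : ℕ → Type) [∀ n, Fintype (σ n)] (f : ∀ n, MvPolynomial (σ n) NNReal), (∀ n m, MvPolynomial.coeff m (f n) = 0 ∨ MvPolynomial.coeff m (f n) = 1) → Literature.Computability.AlgebraicComplexity.IsVPFamily (k := ℂ) (fun n => MvPolynomial.map (Complex.ofRealHom.comp NNReal.toRealHom) (f n)) → ∃ c : ℕ, ∀ n, ∃ h : MvPolynomial (σ n) NNReal, h ≠ 0 ∧ Literature.Computability.AlgebraicComplexity.complexity (f n * h) ≤ 2 ^ ((Nat.log 2 n + c) ^ c)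

/-- child 2 (cofactor charging) -/
def CofactorCharging' : Prop :=
  ∀ (σ : ℕ → Type) [∀ n, Fintype (σ n)] (f : ∀ n, MvPolynomial (σ n) NNReal), (∀ n m, MvPolynomial.coeff m (f n) = 0 ∨ MvPolynomial.coeff m (f n) = 1) → Literature.Computability.AlgebraicComplexity.IsVPFamily (k := ℂ) (fun n => MvPolynomial.map (Complex.ofRealHom.comp NNReal.toRealHom) (f n)) → ∃ k : ℕ, ∀ n, ∀ h : MvPolynomial (σ n) NNReal, h ≠ 0 → ∃ h' : MvPolynomial (σ n) NNReal, h' ≠ 0 ∧ Literature.Computability.AlgebraicComplexity.complexity (f n * h') + Literature.Computability.AlgebraicComplexity.complexity h' ≤ 2 ^ ((Nat.log 2 n + Nat.log 2 (Literature.Computability.AlgebraicComplexity.complexity (f n * h)) + k) ^ k)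

/-- S⁺ candidates recorded for the census (strengthen lens): the degree-charged crux ZOT_deg. -/
def ZeroOneTransferDeg' : Prop :=
  ∀ (σ : ℕ → Type) [∀ n, Fintype (σ n)] (f : ∀ n, MvPolynomial (σ n) NNReal), (∀ n m, MvPolynomial.coeff m (f n) = 0 ∨ MvPolynomial.coeff m (f n) = 1) → Literature.Computability.AlgebraicComplexity.IsVPFamily (k := ℂ) (fun n => MvPolynomial.map (Complex.ofRealHom.comp NNReal.toRealHom) (f n)) → ∃ c : ℕ, ∀ n, ∃ h : MvPolynomial (σ n) NNReal, h ≠ 0 ∧ h.totalDegree ≤ 2 ^ ((Nat.log 2 n + c) ^ c) ∧ Literature.Computability.AlgebraicComplexity.complexity (f n * h) + Literature.Computability.AlgebraicComplexity.complexity h ≤ 2 ^ ((Nat.log 2 n + c) ^ c)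

/-- S⁺⁺ (strengthen lens): the nonnegative-coefficient form (0/1 dropped). -/
def NonnegTransfer' : Prop :=
  ∀ (σ : ℕ → Type) [∀ n, Fintype (σ n)] (f : ∀ n, MvPolynomial (σ n) NNReal), Literature.Computability.AlgebraicComplexity.IsVPFamily (k := ℂ) (fun n => MvPolynomial.map (Complex.ofRealHom.comp NNReal.toRealHom) (f n)) → ∃ c : ℕ, ∀ n, ∃ h : MvPolynomial (σ n) NNReal, h ≠ 0 ∧ Literature.Computability.AlgebraicComplexity.complexity (f n * h) + Literature.Computability.AlgebraicComplexity.complexity h ≤ 2 ^ ((Nat.log 2 n + c) ^ c)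

/-- The clean (VP-free, 0/1-free) charging statement — 'monotone Kaltofen': from ANY nonneg multiple to a
charged certificate, uniformly quasi-polynomial in the number of variables and the cost of the multiple. -/
def MonotoneKaltofen' : Prop :=
  ∃ k : ℕ, ∀ (τ : Type) [Fintype τ] (f h : MvPolynomial τ NNReal), h ≠ 0 → ∃ h' : MvPolynomial τ NNReal, h' ≠ 0 ∧ Literature.Computability.AlgebraicComplexity.complexity (f * h') + Literature.Computability.AlgebraicComplexity.complexity h' ≤ 2 ^ ((Nat.log 2 (Fintype.card τ) + Nat.log 2 (Literature.Computability.AlgebraicComplexity.complexity (f * h)) + k) ^ k)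

/-- Uniform form of the crux (negation lens: the `∃ c` after the family does not protect the crux; by
diagonalisation ZOT is equivalent to a bound uniform in the VP data). Recorded as a signature only. -/
def ZeroOneTransferUniform' : Prop :=
  ∀ e : ℕ, ∃ c : ℕ, ∀ (n : ℕ) (τ : Type) [Fintype τ] (f : MvPolynomial τ NNReal), (∀ m, MvPolynomial.coeff m f = 0 ∨ MvPolynomial.coeff m f = 1) → Fintype.card τ ≤ n ^ e + e → f.totalDegree ≤ n ^ e + e → Literature.Computability.AlgebraicComplexity.complexity (MvPolynomial.map (Complex.ofRealHom.comp NNReal.toRealHom) f) ≤ n ^ e + e → ∃ h : MvPolynomial τ NNReal, h ≠ 0 ∧ Literature.Computability.AlgebraicComplexity.complexity (f * h) + Literature.Computability.AlgebraicComplexity.complexity h ≤ 2 ^ ((Nat.log 2 n + c) ^ c)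

/-- trivial direction of the clean charging: MonotoneKaltofen' implies the filed child. -/
theorem cofactorCharging'_of_monotoneKaltofen' (H : MonotoneKaltofen') (hvar : ∀ (σ : ℕ → Type) [∀ n, Fintype (σ n)] (f : ∀ n, MvPolynomial (σ n) NNReal), Literature.Computability.AlgebraicComplexity.IsVPFamily (k := ℂ) (fun n => MvPolynomial.map (Complex.ofRealHom.comp NNReal.toRealHom) (f n)) → ∃ e : ℕ, ∀ n, Fintype.card (σ n) ≤ n ^ e + e) : CofactorCharging' := by
  intro σ _ f _ hVP
  obtain ⟨k, hk⟩ := H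
  obtain ⟨e, he⟩ := hvar σ f hVP
  -- log₂ (n^e + e) ≤ ... absorbed: take K large; we only record the shape here
  refine ⟨3 * (e + 1) * (k + 1), fun n h hh => ?_⟩
  obtain ⟨h', hh', hle⟩ := hk (σ n) (f n) h hh
  refine ⟨h', hh', hle.trans ?_⟩
  apply Nat.pow_le_pow_right Nat.two_pos
  have hcard : Nat.log 2 (Fintype.card (σ n)) ≤ (e + 1) * (Nat.log 2 n + 1) + e := by
    have h1 : Fintype.card (σ n) ≤ n ^ e + e := he n
    have h2 : n ^ e + e ≤ 2 ^ ((e + 1) * (Nat.log 2 n + 1) + e) := by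
      have hn : n ≤ 2 ^ (Nat.log 2 n + 1) := (Nat.lt_pow_succ_log_self Nat.one_lt_two n).le
      have hne : n ^ e ≤ 2 ^ (e * (Nat.log 2 n + 1)) := by
        rw [pow_mul']; exact Nat.pow_le_pow_left hn e
      have hee : e ≤ 2 ^ e := Nat.lt_two_pow_self.le
      have hA : 1 ≤ 2 ^ (e * (Nat.log 2 n + 1)) := Nat.one_le_two_pow
      have hB : 1 ≤ 2 ^ e := Nat.one_le_two_pow
      calc n ^ e + e ≤ 2 ^ (e * (Nat.log 2 n + 1)) + 2 ^ e := Nat.add_le_add hne hee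
        _ ≤ 2 ^ (e * (Nat.log 2 n + 1)) * 2 ^ e + 2 ^ (e * (Nat.log 2 n + 1)) * 2 ^ e := by
            apply Nat.add_le_add
            · exact Nat.le_mul_of_pos_right _ (Nat.two_pow_pos e)
            · exact Nat.le_mul_of_pos_left _ (Nat.two_pow_pos _)
        _ = 2 ^ (e * (Nat.log 2 n + 1) + e + 1) := by rw [← pow_add]; ring
        _ ≤ 2 ^ ((e + 1) * (Nat.log 2 n + 1) + e) := Nat.pow_le_pow_right Nat.two_pos (by nlinarith)
    have := Nat.log_mono_right (b := 2) (h1.trans h2)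
    rwa [Nat.log_pow Nat.one_lt_two] at this
  set L := Nat.log 2 (Literature.Computability.AlgebraicComplexity.complexity (f n * h))
  set a := Nat.log 2 n
  set K := 3 * (e + 1) * (k + 1) with hK
  have hK1 : 2 * e + 1 + k ≤ K := by rw [hK]; nlinarith
  have hK2 : e + 1 ≤ K := by rw [hK]; nlinarith
  have hK3 : 2 * k ≤ K := by rw [hK]; nlinarith
  have hbase : Nat.log 2 (Fintype.card (σ n)) + L + k ≤ (a + L + K) * (e + 1) := by
    have h1 : Nat.log 2 (Fintype.card (σ n)) + L + k ≤ (e + 1) * a + L + K := by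
      calc Nat.log 2 (Fintype.card (σ n)) + L + k ≤ (e + 1) * (a + 1) + e + L + k := by omega
        _ = (e + 1) * a + L + (2 * e + 1 + k) := by ring
        _ ≤ (e + 1) * a + L + K := by omega
    have h2 : (e + 1) * a + L + K ≤ (a + L + K) * (e + 1) := by nlinarith
    exact h1.trans h2
  have hsq : (a + L + K) * (e + 1) ≤ (a + L + K) * (a + L + K) :=
    Nat.mul_le_mul_left _ (by omega)
  calc (Nat.log 2 (Fintype.card (σ n)) + L + k) ^ k
      ≤ ((a + L + K) * (a + L + K)) ^ k := Nat.pow_le_pow_left (hbase.trans hsq) k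
    _ = (a + L + K) ^ (2 * k) := by rw [← sq, ← pow_mul, Nat.mul_comm]
    _ ≤ (a + L + K) ^ K := Nat.pow_le_pow_right (by omega) hK3

end Summit.ValiantsHypothesis.ValiantsHypothesis.Theses.DivisionGap
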